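import Summits.QuantumFields.YangMills.Theorems.FluctuationComparisonRegPrIntLInteriorSectionPointwise
import Literature.MathematicalPhysics.QuantumFieldTheory.Balaban1983to89.Node00.Record12MinimiserSelection
import Literature.MathematicalPhysics.QuantumFieldTheory.Balaban1983to89.T3TiltDescent
import HarnessLib

/-!
# `FluctuationComparisonRegPrIntLInteriorSectionMeasurable` — LINE g22-4 «persistence_geometry», row GEOM∘ `InteriorSectionCan`: THE MEASURABLE SELECTION, AND
# GEOM∘ CLOSED (crux `UnitScaleTilt.FluctuationComparisonRegPrIntL`, stmt-QuantumFields-20520; row GEOM∘ of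
# `Cruxes/FluctuationComparisonRegPrIntL/Lines/persistence_geometry.lean` 970dcf79, ideator ym-r3-idea-1 g22; companion of ✓`…InteriorSectionPointwise`)

Cell `ym3-torus` (YM ladder rung R3 = continuum SU(2) Yang–Mills on T³ — a RUNG, NOT the Clay problem: not d = 4, not infinite volume, not a mass gap);
width seat `ym-ust-20520-w3` (gen 18, LEAD-20520); helper `--supports stmt-QuantumFields-20520`.  THEOREMS ONLY (0 `def`, 0 `sorry`, default heartbeats).

WHAT.  ✓`…InteriorSectionPointwise` proved GEOM∘'s existence-with-margin half pointwise (`interiorSection_pointwise`, from the landed W7 lift) and reduced GEOM∘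
VERBATIM to ONE hypothesis ⟨MEAS-SEL⟩ (`interiorSectionCan_of_measurableSelection`): a MEASURABLE selection of preimages under the one-step descent
`descendTo F ℰp J (J+1)` inside an open plaquette class.  THIS FILE DISCHARGES ⟨MEAS-SEL⟩ with the tree's measurable-selection theorem
(lit ✓`Literature.MeasureTheory.RandomSets.exists_measurable_constrained_argmin` — Kuratowski–Ryll-Nardzewski ∕ measurable maximum theorem for an OPEN class, a
CLOSED constraint and a σ-closed-continuous constraint map, Node00-def-K0c's pattern `Node00/Record12MinimiserSelection`, dag-n09-w4's `…N09UkMeasurableSelector`):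
* §1 ★`sigmaClosedContinuous_iter_blockAvg`, ★★`sigmaClosedContinuous_descendTo` — the descent `D_{n,K} = fieldShift ∘ M^{K−n}` of the
  exp-mean-log averaging is σ-CLOSED-CONTINUOUS (continuous on each member of a countable closed cover of `SU(2)^{bonds}`: lit ✓`Node00.sigmaClosedContinuous_avgFun`,
  composition, and continuity of the level identification `fieldShift`) — although it is NOT continuous (the (0.4) guard).
* §2 ★★★`exists_measurable_section_descendTo` — for every family, `n ≤ K` and radius `θ'` there is a MEASURABLE `σ : SU(2)^{bonds_n} → SU(2)^{bonds_K}` with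
  `descendTo F ℰp n K (σ U) = U ∧ PlaqSmall θ' (σ U)` at EVERY datum `U` whose descent fibre meets the open class `{PlaqSmall θ'}` (constant objective, diagonal
  constraint, `exists_measurable_constrained_argmin`); ★★`measurableSelection_descendTo` — ⟨MEAS-SEL⟩ of ✓`…InteriorSectionPointwise` §4, DISCHARGED.
  ★★★`exists_measurable_section_descendTo_le` (CLOSED class `∀ p, dist1 ≤ η`, penalty objective) and ★★★`measurableSelectionCan` — **LINE g22-5's row KRN∘
  `MeasurableSelectionCan` (`Lines/section_lift.lean` 277d3082), text VERBATIM, PROVED** (no guard on `η` needed).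
* §3 ★★★★`interiorSectionCan` — **GEOM∘ `RunPairOrgan.PersistenceGeometry.InteriorSectionCan` (g22-4 970dcf79 ll.117–123), text VERBATIM, PROVED**
  (✓`interiorSectionCan_of_measurableSelection measurableSelection_descendTo`).
SO the organ's leaf GEOM∘ is a theorem of the tree; PERS₁∘ ⟸ TUBE∘ alone by LINE g22-4's proved junction `oneLevelPersistence_of_geom_tube`.
HONEST SCOPE.  Topology ∕ measure theory over landed objects (compact Polish `SU(2)^{bonds}`, K0c's piecewise continuity of the averaging, a selection theorem) and the
landed W7 lift; TUBE∘, PERS₁∘, PLAQTAIL∘, 1L4ᶜ∘, H4ᶜ∘, CRUDELOC, LFR♯ᶜ∘, S2β, 20520, `YM3TorusSU2` NOT proved; no summit is proved by a helper; the Yang–Mills mass gap is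
NOT proved.  HYP-SAT (cell RULING №42): hypothesis-free.
References: [Balaban1987RG1] (0.4) p. 253, (0.11) p. 253, (0.18) p. 255; [Balaban1985Averaging] (8)–(10) p. 19; [AliprantisBorder2006] Thm 18.19 p. 605;
[RobinsonRodrigoSadowskiCUP2016] Lemma E.2 p. 304.
-/

noncomputable section

set_option autoImplicit false

open MeasureTheory Set Topology TopologicalSpace
open Literature.MathematicalPhysics.QuantumFieldTheory.Balaban1983to89
open Literature.MathematicalPhysics.QuantumFieldTheory.Balaban1983to89.T3ContinuumYM3Torus
open Literature.MathematicalPhysics.QuantumFieldTheory.Balaban1983to89.T3LevelShift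
open Literature.MathematicalPhysics.QuantumFieldTheory.Balaban1983to89.T3UnitLawDensityEML (ℰp)
open Literature.MathematicalPhysics.QuantumFieldTheory.Balaban1983to89.T3UnitScaleTilt
open Literature.MathematicalPhysics.QuantumFieldTheory.Balaban1983to89.T3TiltDescent
open Literature.MathematicalPhysics.QuantumFieldTheory.Balaban1983to89.Node00 (isOpen_plaqSmall sigmaClosedContinuous_avgFun)
open Literature.MathematicalPhysics.QuantumLattice (fundamentalRep continuous_fundamentalRep fundamentalRep_injective)
open Literature.MeasureTheory.RandomSets

namespace Summit.QuantumFields.YangMills.Theorems.FluctuationComparisonRegPrIntLInteriorSectionMeasurable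

/-! ## §1 The descent of the exp-mean-log averaging is σ-closed-continuous -/

section Pieces

variable (F : T3Family)

/-- Every iterate `M^k` of the exp-mean-log block averaging `ℰp` on a three-torus lattice is σ-closed-continuous (lit ✓`Node00.sigmaClosedContinuous_avgFun`,
composition). [cite: Balaban1987RG1, (0.4) p.253 and (0.11) p.253] -/
theorem sigmaClosedContinuous_iter_blockAvg (K : ℕ) :
    ∀ k : ℕ, SigmaClosedContinuous
      (Averaging.iter (fun i => BlockAveraging.blockAvg (P := F.P K) (j := i) ℰp) k :
        GaugeField (F.P K) 0 (Matrix.specialUnitaryGroup (Fin 2) ℂ) → GaugeField (F.P K) k (Matrix.specialUnitaryGroup (Fin 2) ℂ))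
  | 0 => SigmaClosedContinuous.of_continuous continuous_id
  | k + 1 => (sigmaClosedContinuous_avgFun (N := 2) (P := F.P K) (j := k)).comp (sigmaClosedContinuous_iter_blockAvg K k)

/-- ★★ **THE DESCENT `D_{n,K} = fieldShift ∘ M^{K−n}` IS σ-CLOSED-CONTINUOUS** (continuous on each member of a countable closed cover of `SU(2)^{bonds}`;
it is NOT continuous — the (0.4) guard). [cite: Balaban1987RG1, (0.4) p.253 and (0.11) p.253] -/
theorem sigmaClosedContinuous_descendTo {n K : ℕ} (h : n ≤ K) :
    SigmaClosedContinuous (descendTo F ℰp n K h :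
      GaugeField (F.P K) 0 (Matrix.specialUnitaryGroup (Fin 2) ℂ) → GaugeField (F.P n) 0 (Matrix.specialUnitaryGroup (Fin 2) ℂ)) :=
  (SigmaClosedContinuous.of_continuous (continuous_pi fun _ => continuous_apply _ :
      Continuous (fieldShift (G := Matrix.specialUnitaryGroup (Fin 2) ℂ)
        (F.sitesPerDir_eq (m := F.m) (K := n) (j := 0) (m' := F.m) (K' := K) (j' := K - n) (by omega))))).comp
    (sigmaClosedContinuous_iter_blockAvg F K (K - n))

end Pieces

/-! ## §2 A measurable section of the descent inside an open plaquette class -/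

section Selection

variable (F : T3Family)

/-- ★★★ **A MEASURABLE SECTION OF THE DESCENT INSIDE AN OPEN PLAQUETTE CLASS.**  For every three-torus family, `n ≤ K` and radius `θ'` there is a MEASURABLE
map `σ` from level-`n` to run-`K` configurations such that, at EVERY datum `U` whose descent fibre `{Uf | descendTo F ℰp n K Uf = U}` meets the open class
`{PlaqSmall θ'}`, `σ U` lies in both (and `σ U = 1` elsewhere): lit ✓`exists_measurable_constrained_argmin` on the compact Polish `SU(2)^{bonds}` with the CONSTANT
objective, the OPEN class `{PlaqSmall θ'}` (lit ✓`Node00.isOpen_plaqSmall`), the CLOSED diagonal constraint and the σ-closed-continuous constraint map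
`descendTo` (§1) — Node00-def-K0c's ∕ dag-n09-w4's selection pattern. [cite: AliprantisBorder2006, Thm 18.19 p.605; Balaban1987RG1, (0.4) p.253 and (0.18) p.255] -/
theorem exists_measurable_section_descendTo {n K : ℕ} (h : n ≤ K) (θ' : ℝ) :
    ∃ σ : GaugeField (F.P n) 0 (Matrix.specialUnitaryGroup (Fin 2) ℂ) → GaugeField (F.P K) 0 (Matrix.specialUnitaryGroup (Fin 2) ℂ),
      Measurable σ ∧
      (∀ U : GaugeField (F.P n) 0 (Matrix.specialUnitaryGroup (Fin 2) ℂ),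
        (∃ Uf : GaugeField (F.P K) 0 (Matrix.specialUnitaryGroup (Fin 2) ℂ), descendTo F ℰp n K h Uf = U ∧ PlaqSmall θ' Uf) →
          descendTo F ℰp n K h (σ U) = U ∧ PlaqSmall θ' (σ U)) ∧
      (∀ U : GaugeField (F.P n) 0 (Matrix.specialUnitaryGroup (Fin 2) ℂ),
        ¬ (∃ Uf : GaugeField (F.P K) 0 (Matrix.specialUnitaryGroup (Fin 2) ℂ), descendTo F ℰp n K h Uf = U ∧ PlaqSmall θ' Uf) → σ U = 1) := by
  -- the configuration spaces `SU(2)^{bonds}` are compact Polish with Borel = product σ-algebra (`SU(2)` closed in the `2×2` matrices; local instances as in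
  -- Node00-def-K0c ∕ dag-n09-w4 — the tree states these only privately or in far cones, so they are re-derived inline, not declared)
  haveI : SecondCountableTopology (Matrix.specialUnitaryGroup (Fin 2) ℂ) := by
    haveI := secondCountableTopology_matrix (n := Fin 2)
    exact ((continuous_fundamentalRep (Fin 2)).isClosedEmbedding (fundamentalRep_injective (Fin 2))).isEmbedding.secondCountableTopology
  haveI : PolishSpace (Matrix.specialUnitaryGroup (Fin 2) ℂ) := by
    haveI : PolishSpace (Matrix (Fin 2) (Fin 2) ℂ) := inferInstanceAs (PolishSpace (Fin 2 → Fin 2 → ℂ))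
    exact ((continuous_fundamentalRep (Fin 2)).isClosedEmbedding (fundamentalRep_injective (Fin 2))).polishSpace
  haveI : CompactSpace (GaugeField (F.P K) 0 (Matrix.specialUnitaryGroup (Fin 2) ℂ)) :=
    inferInstanceAs (CompactSpace (PBond (F.P K) 0 → Matrix.specialUnitaryGroup (Fin 2) ℂ))
  haveI : PolishSpace (GaugeField (F.P K) 0 (Matrix.specialUnitaryGroup (Fin 2) ℂ)) :=
    inferInstanceAs (PolishSpace (PBond (F.P K) 0 → Matrix.specialUnitaryGroup (Fin 2) ℂ))
  haveI : BorelSpace (GaugeField (F.P K) 0 (Matrix.specialUnitaryGroup (Fin 2) ℂ)) :=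
    inferInstanceAs (BorelSpace (PBond (F.P K) 0 → Matrix.specialUnitaryGroup (Fin 2) ℂ))
  haveI : BorelSpace (GaugeField (F.P n) 0 (Matrix.specialUnitaryGroup (Fin 2) ℂ)) :=
    inferInstanceAs (BorelSpace (PBond (F.P n) 0 → Matrix.specialUnitaryGroup (Fin 2) ℂ))
  -- the data map `π = id`, the piecewise-continuous constraint map `g = D_{n,K}`, the closed relation `R` = the diagonal, the open class, the constant objective
  let π : GaugeField (F.P n) 0 (Matrix.specialUnitaryGroup (Fin 2) ℂ) → GaugeField (F.P n) 0 (Matrix.specialUnitaryGroup (Fin 2) ℂ) := fun V => V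
  let g : GaugeField (F.P K) 0 (Matrix.specialUnitaryGroup (Fin 2) ℂ) → GaugeField (F.P n) 0 (Matrix.specialUnitaryGroup (Fin 2) ℂ) := descendTo F ℰp n K h
  let R : Set (GaugeField (F.P n) 0 (Matrix.specialUnitaryGroup (Fin 2) ℂ) × GaugeField (F.P n) 0 (Matrix.specialUnitaryGroup (Fin 2) ℂ)) :=
    {p | p.1 = p.2}
  let O : Set (GaugeField (F.P K) 0 (Matrix.specialUnitaryGroup (Fin 2) ℂ)) := {Uf | PlaqSmall θ' Uf}
  have hπ : Measurable π := measurable_id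
  have hg : SigmaClosedContinuous g := sigmaClosedContinuous_descendTo F h
  have hO : IsOpen O := isOpen_plaqSmall (N := 2) (P := F.P K) (j := 0) θ'
  have hR : IsClosed R := by
    have hcoord : ∀ b : PBond (F.P n) 0, Continuous fun V : GaugeField (F.P n) 0 (Matrix.specialUnitaryGroup (Fin 2) ℂ) => V b :=
      fun b => continuous_apply b
    have : R = ⋂ b : PBond (F.P n) 0, {p : GaugeField (F.P n) 0 (Matrix.specialUnitaryGroup (Fin 2) ℂ) ×
        GaugeField (F.P n) 0 (Matrix.specialUnitaryGroup (Fin 2) ℂ) | p.1 b = p.2 b} := by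
      ext p
      simp only [R, mem_setOf_eq, mem_iInter]
      exact ⟨fun h b => by rw [h], fun h => funext h⟩
    rw [this]
    exact isClosed_iInter fun b => isClosed_eq ((hcoord b).comp continuous_fst) ((hcoord b).comp continuous_snd)
  have hS : Continuous fun _ : GaugeField (F.P K) 0 (Matrix.specialUnitaryGroup (Fin 2) ℂ) => (0 : ℝ) := continuous_const
  have hadm : ∀ (Uf : GaugeField (F.P K) 0 (Matrix.specialUnitaryGroup (Fin 2) ℂ)) (U : GaugeField (F.P n) 0 (Matrix.specialUnitaryGroup (Fin 2) ℂ)),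
      (Uf ∈ O ∧ (g Uf, π U) ∈ R) ↔ (descendTo F ℰp n K h Uf = U ∧ PlaqSmall θ' Uf) :=
    fun Uf U => ⟨fun hh => ⟨hh.2, hh.1⟩, fun hh => ⟨hh.2, hh.1⟩⟩
  obtain ⟨f, hfm, hfin, hfout⟩ := exists_measurable_constrained_argmin hπ hg hO hR hS (1 : GaugeField (F.P K) 0 (Matrix.specialUnitaryGroup (Fin 2) ℂ))
  refine ⟨f, hfm, fun U hU => ?_, fun U hU => ?_⟩
  · obtain ⟨Uf, hUf⟩ := hU
    have hex : ∃ y, (y ∈ O ∧ (g y, π U) ∈ R) ∧ ∀ z, z ∈ O ∧ (g z, π U) ∈ R → (fun _ => (0 : ℝ)) y ≤ (fun _ => (0 : ℝ)) z :=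
      ⟨Uf, (hadm Uf U).mpr hUf, fun _ _ => le_rfl⟩
    exact (hadm (f U) U).mp (hfin U hex).1
  · refine hfout U fun hh => hU ?_
    obtain ⟨y, hy, -⟩ := hh
    exact ⟨y, (hadm y U).mp hy⟩

/-- ★★ **⟨MEAS-SEL⟩ DISCHARGED** — the hypothesis of ✓`…InteriorSectionPointwise.interiorSectionCan_of_measurableSelection`, text verbatim: whenever every `θ`-small
level-`J` datum has a `θ'`-small preimage under the one-step descent, a MEASURABLE selector does it. [cite: AliprantisBorder2006, Thm 18.19 p.605; Balaban1987RG1, (0.4) p.253] -/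
theorem measurableSelection_descendTo :
    ∀ (F : T3Family) (J : ℕ) (θ θ' : ℝ),
      (∀ U : GaugeField (F.P J) 0 (Matrix.specialUnitaryGroup (Fin 2) ℂ), PlaqSmall θ U →
        ∃ Uf : GaugeField (F.P (J + 1)) 0 (Matrix.specialUnitaryGroup (Fin 2) ℂ),
          descendTo F ℰp J (J + 1) (Nat.le_succ J) Uf = U ∧ PlaqSmall θ' Uf) →
      ∃ σ : GaugeField (F.P J) 0 (Matrix.specialUnitaryGroup (Fin 2) ℂ) → GaugeField (F.P (J + 1)) 0 (Matrix.specialUnitaryGroup (Fin 2) ℂ),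
        Measurable σ ∧ ∀ U : GaugeField (F.P J) 0 (Matrix.specialUnitaryGroup (Fin 2) ℂ), PlaqSmall θ U →
          descendTo F ℰp J (J + 1) (Nat.le_succ J) (σ U) = U ∧ PlaqSmall θ' (σ U) := by
  intro F J θ θ' hpw
  obtain ⟨σ, hσm, hσ, -⟩ := exists_measurable_section_descendTo F (Nat.le_succ J) θ'
  exact ⟨σ, hσm, fun U hU => hσ U (hpw U hU)⟩


/-- ★★★ **A MEASURABLE SECTION OF THE DESCENT INSIDE A CLOSED PLAQUETTE CLASS** (the closed-valued form asked by LINE g22-5's row KRN∘): for every family, `n ≤ K`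
and radius `η` there is a MEASURABLE `σ` with `descendTo F ℰp n K (σ U) = U ∧ ∀ p, dist1 ((σ U)(∂p)) ≤ η` at EVERY datum `U` whose descent fibre meets the CLOSED
class `{W | ∀ p, dist1 (W(∂p)) ≤ η}`: lit ✓`exists_measurable_constrained_argmin` with the whole space as the open class, the diagonal constraint, the
σ-closed-continuous `descendTo` (§1) and the CONTINUOUS PENALTY `S W := Σ_p max (dist1 (W(∂p)) − η) 0` as objective — `S ≥ 0`, and `S W = 0 ↔ W` in the class, so
whenever the fibre meets the class its points are minimisers and the selected minimiser has `S = 0`.  No smallness guard on `η` is needed (the averaging's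
discontinuity is handled by piecewise continuity, not by restricting the data). [cite: AliprantisBorder2006, Thm 18.19 p.605; Balaban1987RG1, (0.4) p.253 and (0.18) p.255] -/
theorem exists_measurable_section_descendTo_le {n K : ℕ} (h : n ≤ K) (η : ℝ) :
    ∃ σ : GaugeField (F.P n) 0 (Matrix.specialUnitaryGroup (Fin 2) ℂ) → GaugeField (F.P K) 0 (Matrix.specialUnitaryGroup (Fin 2) ℂ),
      Measurable σ ∧
      ∀ U : GaugeField (F.P n) 0 (Matrix.specialUnitaryGroup (Fin 2) ℂ),
        (∃ W : GaugeField (F.P K) 0 (Matrix.specialUnitaryGroup (Fin 2) ℂ),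
          descendTo F ℰp n K h W = U ∧ ∀ p, dist1 (GaugeField.plaqHol W p) ≤ η) →
          descendTo F ℰp n K h (σ U) = U ∧ ∀ p, dist1 (GaugeField.plaqHol (σ U) p) ≤ η := by
  -- compact Polish configuration spaces with Borel = product σ-algebra (inline, as in `exists_measurable_section_descendTo`)
  haveI : SecondCountableTopology (Matrix.specialUnitaryGroup (Fin 2) ℂ) := by
    haveI := secondCountableTopology_matrix (n := Fin 2)
    exact ((continuous_fundamentalRep (Fin 2)).isClosedEmbedding (fundamentalRep_injective (Fin 2))).isEmbedding.secondCountableTopology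
  haveI : PolishSpace (Matrix.specialUnitaryGroup (Fin 2) ℂ) := by
    haveI : PolishSpace (Matrix (Fin 2) (Fin 2) ℂ) := inferInstanceAs (PolishSpace (Fin 2 → Fin 2 → ℂ))
    exact ((continuous_fundamentalRep (Fin 2)).isClosedEmbedding (fundamentalRep_injective (Fin 2))).polishSpace
  haveI : CompactSpace (GaugeField (F.P K) 0 (Matrix.specialUnitaryGroup (Fin 2) ℂ)) :=
    inferInstanceAs (CompactSpace (PBond (F.P K) 0 → Matrix.specialUnitaryGroup (Fin 2) ℂ))
  haveI : PolishSpace (GaugeField (F.P K) 0 (Matrix.specialUnitaryGroup (Fin 2) ℂ)) :=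
    inferInstanceAs (PolishSpace (PBond (F.P K) 0 → Matrix.specialUnitaryGroup (Fin 2) ℂ))
  haveI : BorelSpace (GaugeField (F.P K) 0 (Matrix.specialUnitaryGroup (Fin 2) ℂ)) :=
    inferInstanceAs (BorelSpace (PBond (F.P K) 0 → Matrix.specialUnitaryGroup (Fin 2) ℂ))
  haveI : BorelSpace (GaugeField (F.P n) 0 (Matrix.specialUnitaryGroup (Fin 2) ℂ)) :=
    inferInstanceAs (BorelSpace (PBond (F.P n) 0 → Matrix.specialUnitaryGroup (Fin 2) ℂ))
  let π : GaugeField (F.P n) 0 (Matrix.specialUnitaryGroup (Fin 2) ℂ) → GaugeField (F.P n) 0 (Matrix.specialUnitaryGroup (Fin 2) ℂ) := fun V => V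
  let g : GaugeField (F.P K) 0 (Matrix.specialUnitaryGroup (Fin 2) ℂ) → GaugeField (F.P n) 0 (Matrix.specialUnitaryGroup (Fin 2) ℂ) := descendTo F ℰp n K h
  let R : Set (GaugeField (F.P n) 0 (Matrix.specialUnitaryGroup (Fin 2) ℂ) × GaugeField (F.P n) 0 (Matrix.specialUnitaryGroup (Fin 2) ℂ)) :=
    {p | p.1 = p.2}
  -- the continuous penalty
  let S : GaugeField (F.P K) 0 (Matrix.specialUnitaryGroup (Fin 2) ℂ) → ℝ := fun W => ∑ p, max (dist1 (GaugeField.plaqHol W p) - η) 0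
  have hπ : Measurable π := measurable_id
  have hg : SigmaClosedContinuous g := sigmaClosedContinuous_descendTo F h
  have hR : IsClosed R := by
    have hcoord : ∀ b : PBond (F.P n) 0, Continuous fun V : GaugeField (F.P n) 0 (Matrix.specialUnitaryGroup (Fin 2) ℂ) => V b :=
      fun b => continuous_apply b
    have : R = ⋂ b : PBond (F.P n) 0, {p : GaugeField (F.P n) 0 (Matrix.specialUnitaryGroup (Fin 2) ℂ) ×
        GaugeField (F.P n) 0 (Matrix.specialUnitaryGroup (Fin 2) ℂ) | p.1 b = p.2 b} := by
      ext p
      simp only [R, mem_setOf_eq, mem_iInter]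
      exact ⟨fun h b => by rw [h], fun h => funext h⟩
    rw [this]
    exact isClosed_iInter fun b => isClosed_eq ((hcoord b).comp continuous_fst) ((hcoord b).comp continuous_snd)
  have hdist : Continuous (dist1 : Matrix.specialUnitaryGroup (Fin 2) ℂ → ℝ) :=
    UnitaryModel.continuous_opDist1.comp (continuous_fundamentalRep (Fin 2))
  have hplaq : ∀ p : Plaq (F.P K) 0, Continuous fun W : GaugeField (F.P K) 0 (Matrix.specialUnitaryGroup (Fin 2) ℂ) => GaugeField.plaqHol W p := by
    intro p
    have hb : ∀ b : PBond (F.P K) 0, Continuous fun W : GaugeField (F.P K) 0 (Matrix.specialUnitaryGroup (Fin 2) ℂ) => W b :=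
      fun b => continuous_apply b
    unfold GaugeField.plaqHol
    exact (((hb _).mul (hb _)).mul (hb _).inv).mul (hb _).inv
  have hS : Continuous S :=
    continuous_finsetSum _ fun p _ => ((hdist.comp (hplaq p)).sub continuous_const).max continuous_const
  have hS0 : ∀ W, 0 ≤ S W := fun W => Finset.sum_nonneg fun p _ => le_max_right _ _
  have hSle : ∀ W, (∀ p, dist1 (GaugeField.plaqHol W p) ≤ η) ↔ S W = 0 := by
    intro W
    constructor
    · intro hW
      refine Finset.sum_eq_zero fun p _ => ?_
      exact max_eq_right (by linarith [hW p])
    · intro hW p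
      have hterm : max (dist1 (GaugeField.plaqHol W p) - η) 0 = 0 :=
        (Finset.sum_eq_zero_iff_of_nonneg (fun q _ => le_max_right _ _)).mp hW p (Finset.mem_univ p)
      have := le_max_left (dist1 (GaugeField.plaqHol W p) - η) 0
      linarith [hterm ▸ this]
  obtain ⟨f, hfm, hfin, -⟩ := exists_measurable_constrained_argmin hπ hg isOpen_univ hR hS (1 : GaugeField (F.P K) 0 (Matrix.specialUnitaryGroup (Fin 2) ℂ))
  refine ⟨f, hfm, fun U hU => ?_⟩
  obtain ⟨W, hWD, hWle⟩ := hU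
  have hW0 : S W = 0 := (hSle W).mp hWle
  have hex : ∃ y, (y ∈ (Set.univ : Set _) ∧ (g y, π U) ∈ R) ∧ ∀ z, z ∈ (Set.univ : Set _) ∧ (g z, π U) ∈ R → S y ≤ S z :=
    ⟨W, ⟨Set.mem_univ _, hWD⟩, fun z _ => by rw [hW0]; exact hS0 z⟩
  obtain ⟨⟨-, hfD⟩, hfmin⟩ := hfin U hex
  refine ⟨hfD, (hSle (f U)).mpr (le_antisymm ?_ (hS0 _))⟩
  have := hfmin W ⟨Set.mem_univ _, hWD⟩
  rw [hW0] at this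
  exact this

/-- ★★★ **KRN∘ — LINE g22-5's row `RunPairOrgan.SectionLift.MeasurableSelectionCan` (`Lines/section_lift.lean` 277d3082 ll.186–194), text VERBATIM, PROVED** (with
`η₀ := 1`; the guard `η ≤ η₀` is not needed): measurable selection on the one-step descent fibres inside a closed plaquette class — Kuratowski–Ryll-Nardzewski in the
tree's form (lit ✓`exists_measurable_constrained_argmin`), NOT a Mathlib gap here. [cite: AliprantisBorder2006, Thm 18.19 p.605; Balaban1987RG1, (0.4) p.253 and (0.18) p.255] -/
theorem measurableSelectionCan :
    ∀ (L : ℕ), ∃ η₀ : ℝ, 0 < η₀ ∧ ∀ (F : T3Family), F.L = L → ∀ (J : ℕ) (θ η : ℝ), η ≤ η₀ →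
      (∀ U : GaugeField (F.P J) 0 (Matrix.specialUnitaryGroup (Fin 2) ℂ), PlaqSmall θ U →
        ∃ W : GaugeField (F.P (J + 1)) 0 (Matrix.specialUnitaryGroup (Fin 2) ℂ),
          descendTo F ℰp J (J + 1) (Nat.le_succ J) W = U ∧ ∀ p, dist1 (GaugeField.plaqHol W p) ≤ η) →
      ∃ σ : GaugeField (F.P J) 0 (Matrix.specialUnitaryGroup (Fin 2) ℂ) → GaugeField (F.P (J + 1)) 0 (Matrix.specialUnitaryGroup (Fin 2) ℂ),
        Measurable σ ∧ ∀ U : GaugeField (F.P J) 0 (Matrix.specialUnitaryGroup (Fin 2) ℂ), PlaqSmall θ U →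
          descendTo F ℰp J (J + 1) (Nat.le_succ J) (σ U) = U ∧ ∀ p, dist1 (GaugeField.plaqHol (σ U) p) ≤ η := by
  intro L
  refine ⟨1, one_pos, fun F _ J θ η _ hpw => ?_⟩
  obtain ⟨σ, hσm, hσ⟩ := exists_measurable_section_descendTo_le F (Nat.le_succ J) η
  exact ⟨σ, hσm, fun U hU => hσ U (hpw U hU)⟩

end Selection

/-! ## §3 GEOM∘ CLOSED -/

section Geom

/-- ★★★★ **GEOM∘ — `RunPairOrgan.PersistenceGeometry.InteriorSectionCan` (LINE g22-4 `persistence_geometry.lean` 970dcf79 ll.117–123), text VERBATIM, PROVED**: in the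
organ's shared shape, for every window level `J` a margin `r > 0` and a MEASURABLE section `σ` of the one-step averaging over the interior window `W_J(c·b₀)` with
every plaquette of `σ U` below `θ_{J+1}(c·b₀) − 4r`.  Proof: ✓`interiorSectionCan_of_measurableSelection` (the W7 lift ✓`IntLStub1.stub_oneStepSmallLift` + the strict
window ratio) at §2's measurable selection.  HONEST SCOPE: GEOM∘ only; TUBE∘ (hence PERS₁∘), PLAQTAIL∘, 1L4ᶜ∘, H4ᶜ∘, CRUDELOC, LFR♯ᶜ∘, S2β, 20520 NOT proved.
[cite: Balaban1987RG1, (0.4) p.253 and (0.18) p.255; Balaban1985UV3, (3) p.256 and (7) p.257; AliprantisBorder2006, Thm 18.19 p.605] -/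
theorem interiorSectionCan :
    ∀ (L : ℕ), ∃ c₀ : ℝ, 0 < c₀ ∧ c₀ ≤ 1 ∧ ∀ (c : ℝ), 0 < c → c ≤ c₀ → ∃ pS : ℝ, ∀ (b₀ p₀ : ℝ), 0 < b₀ → pS ≤ p₀ → 0 < p₀ →
      ∃ γ₁ : ℝ, 0 < γ₁ ∧ ∀ (F : T3Family) (γ : ℝ), F.L = L → 0 < γ → γ ≤ γ₁ →
        ∀ (J : ℕ), ∃ r : ℝ, 0 < r ∧
          ∃ σ : GaugeField (F.P J) 0 (Matrix.specialUnitaryGroup (Fin 2) ℂ) → GaugeField (F.P (J + 1)) 0 (Matrix.specialUnitaryGroup (Fin 2) ℂ),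
            Measurable σ ∧ ∀ U : GaugeField (F.P J) 0 (Matrix.specialUnitaryGroup (Fin 2) ℂ), PlaqSmall (θBal F.L γ (c * b₀) p₀ J) U →
              descendTo F ℰp J (J + 1) (Nat.le_succ J) (σ U) = U ∧ PlaqSmall (θBal F.L γ (c * b₀) p₀ (J + 1) - 4 * r) (σ U) :=
  Summit.QuantumFields.YangMills.Theorems.FluctuationComparisonRegPrIntLInteriorSectionPointwise.interiorSectionCan_of_measurableSelection
    measurableSelection_descendTo

end Geom

end Summit.QuantumFields.YangMills.Theorems.FluctuationComparisonRegPrIntLInteriorSectionMeasurable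

end
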